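import Mathlib
import HarnessLib
import Summits.NavierStokesRegularity.NavierStokesRegularity.Theorems.PoloidalWindowDoorPoloidalWindowRigidityTimeHeightShearNormalForm
import Summits.NavierStokesRegularity.NavierStokesRegularity.Theorems.PoloidalWindowDoorLrcModEntireTwistingTHBranchRoad
import Summits.NavierStokesRegularity.NavierStokesRegularity.Theorems.PoloidalWindowDoorLrcModEntireTwistingTHSlopeRates

/-!
# Item `LrcModEntire` (stmt-NavierStokesRegularity-20428), skeleton twist_split v6 — (BRANCH) road: the GLOBAL SLOPE from the window and
# non-flatness (the `C³` hypothesis on the slope is automatic), and the road from «no h-flat plane + (SD) + (BR)»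

Cell ns-regularity-ideate, seat ns-k2-port-2 g4 (kernel-port lineage; `--supports stmt-NavierStokesRegularity-20428 --as helper`; answer to the LEAD
ns-poloidal-K2-p3 g13's remark STATUS 2026-08-29T04:28:42Z on the (BRANCH) hypothesis list, option (i): «take "no h-flat plane for s<0" as an explicit
hypothesis»).  Sequel of `…TwistingTHBranchRoad`.

* `contDiffOn_slope_of_nonflat` — a GLOBAL (TH) slope `μ` (`∂₂v_b = μ(s,y₂)∂_b v₂` on the whole slab) of a class profile is `C³` (indeed analytic)
  on the open slab as soon as NO plane is h-flat (`∀ s<0, ∀ c, ∃ y, y₂ = c, ∃ b ≠ 2, ∂_b v₂(s,y) ≠ 0`): `…TimeHeightShearNormalForm.analyticAt_planeSlope`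
  at one non-flat point of each plane.  So the `hμC` hypothesis of `…TwistingTHBranchLaw`/`…BranchObject`/`…BranchRoad` is not an extra assumption;
* `exists_globalSlope_of_window_nonflat` — a (TH) WINDOW + no h-flat plane ⇒ such a global slope exists (`timeHeightShear_normalForm` forbids nothing
  but flat-or-proportional-shear planes; non-flatness picks the shear branch; choice);
* `twistingTHGerm_of_branches_nonflat` — the registered signature of `stub_twistingTHGerm` VERBATIM from «every normalised windowed poloidal class
  profile has no h-flat plane and admits a global slope with the slope dictionary (SD) and `C²` extremizer branches (BR)» — `twistingTHGerm_of_branches`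
  with `hμC` discharged.  (The h-flat-plane case is the LEAD's / K2-p2's flat-slice cell, killed separately: `…FlatSlicePressure` etc.)
* `twistingTHGerm_of_branches_uniform` — **the slope ELIMINATED**: the stub VERBATIM from «every normalised windowed poloidal class profile is UNIFORMLY
  NON-FLAT in similarity units (`∃ g₀ > 0, k: ∀ t<0 ∀ z ∃ y (y₂ = z) ∃ b ≠ 2, g₀(1+z²/(−t))^{−k} ≤ (−t)|∂_b v₂(t,y)|`) and admits `C²` extremizer branches
  (BR)» — the global slope comes from `exists_globalSlope_of_window_nonflat`, its dictionary (SD) from `…TwistingTHSlopeRates.slopeRates_of_nonflat`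
  (exponent `3k`).  THIS IS THE TYPED WALL OF THE (TH) COLUMN after this seat: uniform non-flatness + (BR).

WHAT THIS IS NOT: not a claim about Navier–Stokes regularity and not a proof of the stub — a reduction BY NAME; (BR)+(SD)+«no h-flat plane» is the wall,
typed, not proved (bears_on LADDER-NS N0, item 20428 / crux 19708; both OPEN).
-/

noncomputable section

-- the summit and its single sub-problem share the name (CONVENTIONS §1), as in every Theorems file
set_option linter.dupNamespace false

namespace Summit.NavierStokesRegularity.NavierStokesRegularity.Theorems.PoloidalWindowDoorLrcModEntireTwistingTHGlobalSlope

open Set Function Filter Topology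
open scoped RealInnerProductSpace InnerProductSpace Laplacian
open Literature.Analysis Literature.Analysis.FluidPDE
open Summit.NavierStokesRegularity.NavierStokesRegularity.Theorems.PoloidalWindowDoorPoloidalWindowRigidityTimeHeightShearNormalForm
open Summit.NavierStokesRegularity.NavierStokesRegularity.Theorems.PoloidalWindowDoorLrcModEntireTwistingTHBranchRoad
open Summit.NavierStokesRegularity.NavierStokesRegularity.Theorems.PoloidalWindowDoorLrcModEntireTwistingTHSlopeRates

section Class

variable {C : ℝ} {v : ℝ → EuclideanSpace ℝ (Fin 3) → EuclideanSpace ℝ (Fin 3)}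
variable (hrate : HasTypeITimeDecay C v) (hcont : ContinuousOn (uncurry v) (Iio (0 : ℝ) ×ˢ univ))
  (hmild : ∀ s t : ℝ, s < t → t < 0 → ∀ x,
    v t x = UnboundedOperators.heatExtension (v s) (t - s) x - oseenDuhamel 1 s v v t x)

include hrate hcont hmild

/-- **A global (TH) slope is `C³` on the open slab if no plane is h-flat** (analytic, by `analyticAt_planeSlope` at a non-flat point of each plane). -/
theorem contDiffOn_slope_of_nonflat {μ : ℝ → ℝ → ℝ}
    (hTH : ∀ s < 0, ∀ y : EuclideanSpace ℝ (Fin 3), ∀ b : Fin 3, b ≠ 2 →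
      fderiv ℝ (v s) y (EuclideanSpace.single 2 1) b = μ s (y 2) * fderiv ℝ (v s) y (EuclideanSpace.single b 1) 2)
    (hnf : ∀ s < 0, ∀ c : ℝ, ∃ y : EuclideanSpace ℝ (Fin 3), ∃ b : Fin 3,
      y 2 = c ∧ b ≠ 2 ∧ fderiv ℝ (v s) y (EuclideanSpace.single b 1) 2 ≠ 0) :
    ContDiffOn ℝ 3 (uncurry μ) (Iio (0 : ℝ) ×ˢ univ) := by
  rintro ⟨s, c⟩ hp
  obtain ⟨hs, -⟩ := mem_prod.1 hp
  obtain ⟨y, b, hy, hb, hne⟩ := hnf s hs c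
  have han := analyticAt_planeSlope hrate hcont hmild hTH hs hb hne
  rw [hy] at han
  exact han.contDiffAt.contDiffWithinAt

/-- **A (TH) window + no h-flat plane ⇒ a global (TH) slope.**  (`timeHeightShear_normalForm`: every plane of every slice is flat or proportional-shear;
non-flatness excludes the first alternative; choose the slope plane by plane.) -/
theorem exists_globalSlope_of_window_nonflat
    {W : Set (ℝ × EuclideanSpace ℝ (Fin 3))} (hW : IsOpen W) (hWne : W.Nonempty) (hWs : W ⊆ Iio (0 : ℝ) ×ˢ univ)
    {m : ℝ → ℝ → ℝ}
    (h : ∀ z ∈ W, ∀ b : Fin 3, b ≠ 2 →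
      fderiv ℝ (v z.1) z.2 (EuclideanSpace.single 2 1) b = m z.1 (z.2 2) * fderiv ℝ (v z.1) z.2 (EuclideanSpace.single b 1) 2)
    (hnf : ∀ s < 0, ∀ c : ℝ, ∃ y : EuclideanSpace ℝ (Fin 3), ∃ b : Fin 3,
      y 2 = c ∧ b ≠ 2 ∧ fderiv ℝ (v s) y (EuclideanSpace.single b 1) 2 ≠ 0) :
    ∃ μ : ℝ → ℝ → ℝ, (∀ s < 0, ∀ y : EuclideanSpace ℝ (Fin 3), ∀ b : Fin 3, b ≠ 2 →
        fderiv ℝ (v s) y (EuclideanSpace.single 2 1) b = μ s (y 2) * fderiv ℝ (v s) y (EuclideanSpace.single b 1) 2) ∧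
      ContDiffOn ℝ 3 (uncurry μ) (Iio (0 : ℝ) ×ˢ univ) := by
  have hNF := timeHeightShear_normalForm hrate hcont hmild hW hWne hWs h
  -- on every plane of every slice, the proportional-shear alternative holds
  have hshear : ∀ s < 0, ∀ c : ℝ, ∃ μ₀ : ℝ, ∀ y : EuclideanSpace ℝ (Fin 3), y 2 = c → ∀ b : Fin 3, b ≠ 2 →
      fderiv ℝ (v s) y (EuclideanSpace.single 2 1) b = μ₀ * fderiv ℝ (v s) y (EuclideanSpace.single b 1) 2 := by
    intro s hs c
    rcases hNF s hs c with hflat | hμ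
    · obtain ⟨y, b, hy, hb, hne⟩ := hnf s hs c
      have h0 := hflat y hy
      exact absurd (by fin_cases b <;> simp_all) hne
    · exact hμ
  classical
  refine ⟨fun s c => if hs : s < 0 then Classical.choose (hshear s hs c) else 0, ?_, ?_⟩
  · intro s hs y b hb
    have hspec := Classical.choose_spec (hshear s hs (y 2)) y rfl b hb
    simp only [dif_pos hs]
    exact hspec
  · refine contDiffOn_slope_of_nonflat hrate hcont hmild (fun s hs y b hb => ?_) hnf
    have hspec := Classical.choose_spec (hshear s hs (y 2)) y rfl b hb
    simp only [dif_pos hs]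
    exact hspec

end Class

/-- **THE CLASS ROAD TO `stub_twistingTHGerm` BY NAME FROM «NO h-FLAT PLANE + (SD) + (BR)»** (`twistingTHGerm_of_branches` with the `C³`-slope
hypothesis discharged by `contDiffOn_slope_of_nonflat`). -/
theorem twistingTHGerm_of_branches_nonflat
    (hBR : ∀ (C : ℝ) (v : ℝ → EuclideanSpace ℝ (Fin 3) → EuclideanSpace ℝ (Fin 3)),
      Literature.Analysis.FluidPDE.HasTypeITimeDecay C v →
      ContinuousOn (Function.uncurry v) (Set.Iio (0 : ℝ) ×ˢ Set.univ) →
      (∀ s t : ℝ, s < t → t < 0 → ∀ x, v t x =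
        Literature.Analysis.UnboundedOperators.heatExtension (v s) (t - s) x -
          Literature.Analysis.FluidPDE.oseenDuhamel 1 s v v t x) →
      (∀ t < 0, Literature.Analysis.FluidPDE.VectorCalculus.IsDivFree (v t)) →
      (∀ s < 0, ∀ y, ⟪Literature.Analysis.FluidPDE.curl (v s) y, EuclideanSpace.single 2 1⟫_ℝ = 0) →
      v (-1) 0 2 ≠ 0 → (∀ t < 0, ∀ x, Real.sqrt (-t) * |v t x 2| ≤ |v (-1) 0 2|) →
      ∀ W : Set (ℝ × EuclideanSpace ℝ (Fin 3)), IsOpen W → W.Nonempty → W ⊆ Set.Iio (0 : ℝ) ×ˢ Set.univ →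
        (∃ m : ℝ → ℝ → ℝ, ∀ z ∈ W, ∀ b : Fin 3, b ≠ 2 →
            fderiv ℝ (v z.1) z.2 (EuclideanSpace.single 2 1) b =
              m z.1 (z.2 2) * fderiv ℝ (v z.1) z.2 (EuclideanSpace.single b 1) 2) →
        (∀ s < 0, ∀ c : ℝ, ∃ y : EuclideanSpace ℝ (Fin 3), ∃ b : Fin 3,
            y 2 = c ∧ b ≠ 2 ∧ fderiv ℝ (v s) y (EuclideanSpace.single b 1) 2 ≠ 0) ∧
        ∃ (μ : ℝ → ℝ → ℝ) (Kμ : ℝ) (k : ℕ) (xp xm : ℝ → ℝ → EuclideanSpace ℝ (Fin 3)) (B₁ : ℝ),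
          (∀ s < 0, ∀ y : EuclideanSpace ℝ (Fin 3), ∀ b : Fin 3, b ≠ 2 →
            fderiv ℝ (v s) y (EuclideanSpace.single 2 1) b = μ s (y 2) * fderiv ℝ (v s) y (EuclideanSpace.single b 1) 2) ∧
          (∀ t < 0, ∀ z, |μ t z| ≤ Kμ * (1 + z ^ 2 / (-t)) ^ k) ∧
          (∀ t < 0, ∀ z, (-t) * |deriv (fun s => μ s z) t| ≤ Kμ * (1 + z ^ 2 / (-t)) ^ k) ∧
          (∀ t < 0, ∀ z, Real.sqrt (-t) * |deriv (μ t) z| ≤ Kμ * (1 + z ^ 2 / (-t)) ^ k) ∧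
          (∀ t < 0, ∀ z, (-t) * |deriv (deriv (μ t)) z| ≤ Kμ * (1 + z ^ 2 / (-t)) ^ k) ∧
          (∀ t < 0, ∀ z, xp t z 2 = z) ∧ (∀ t < 0, ∀ z, xm t z 2 = z) ∧
          ContDiffOn ℝ 2 (Function.uncurry xp) (Set.Iio (0 : ℝ) ×ˢ Set.univ) ∧
          ContDiffOn ℝ 2 (Function.uncurry xm) (Set.Iio (0 : ℝ) ×ˢ Set.univ) ∧
          (∀ t < 0, ∀ z, ∀ y : EuclideanSpace ℝ (Fin 3), y 2 = z → v t y 2 ≤ v t (xp t z) 2) ∧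
          (∀ t < 0, ∀ z, ∀ y : EuclideanSpace ℝ (Fin 3), y 2 = z → v t (xm t z) 2 ≤ v t y 2) ∧
          (∀ t < 0, ∀ z, ‖deriv (xp t) z‖ ≤ B₁ * (1 + z ^ 2 / (-t)) ^ k) ∧
          (∀ t < 0, ∀ z, ‖deriv (xm t) z‖ ≤ B₁ * (1 + z ^ 2 / (-t)) ^ k)) :
    ∀ (C : ℝ) (v : ℝ → EuclideanSpace ℝ (Fin 3) → EuclideanSpace ℝ (Fin 3)),
      Literature.Analysis.FluidPDE.HasTypeITimeDecay C v →
      ContinuousOn (Function.uncurry v) (Set.Iio (0 : ℝ) ×ˢ Set.univ) →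
      (∀ s t : ℝ, s < t → t < 0 → ∀ x, v t x =
        Literature.Analysis.UnboundedOperators.heatExtension (v s) (t - s) x -
          Literature.Analysis.FluidPDE.oseenDuhamel 1 s v v t x) →
      (∀ t < 0, Literature.Analysis.FluidPDE.VectorCalculus.IsDivFree (v t)) →
      (∀ s < 0, ∀ y, ⟪Literature.Analysis.FluidPDE.curl (v s) y, EuclideanSpace.single 2 1⟫_ℝ = 0) →
      v (-1) 0 2 ≠ 0 → (∀ t < 0, ∀ x, Real.sqrt (-t) * |v t x 2| ≤ |v (-1) 0 2|) →
      (∀ h : EuclideanSpace ℝ (Fin 3), fderiv ℝ (v (-1)) 0 h 2 = 0) →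
      (deriv (fun s => v s 0 2) (-1) = v (-1) 0 2 / 2 ∧ v (-1) 0 2 * (Δ (fun y => v (-1) y 2)) 0 ≤ 0) →
      ∀ W : Set (ℝ × EuclideanSpace ℝ (Fin 3)), IsOpen W → W.Nonempty → W ⊆ Set.Iio (0 : ℝ) ×ˢ Set.univ →
        (∀ z ∈ W, (Literature.Analysis.FluidPDE.curl (v z.1) z.2 ≠ 0 ∧
            (fderiv ℝ (v z.1) z.2 (EuclideanSpace.single 0 1) 2 ≠ 0 ∨ fderiv ℝ (v z.1) z.2 (EuclideanSpace.single 1 1) 2 ≠ 0) ∧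
            (fderiv ℝ (v z.1) z.2 (EuclideanSpace.single 2 1) 0 ≠ 0 ∨ fderiv ℝ (v z.1) z.2 (EuclideanSpace.single 2 1) 1 ≠ 0))) →
        (∀ m : ℝ → ℝ, ∀ W₁ : Set (ℝ × EuclideanSpace ℝ (Fin 3)), W₁ ⊆ W → IsOpen W₁ → W₁.Nonempty →
            ∃ z ∈ W₁, ∃ b : Fin 3, b ≠ 2 ∧
              fderiv ℝ (v z.1) z.2 (EuclideanSpace.single 2 1) b ≠
                m z.1 * fderiv ℝ (v z.1) z.2 (EuclideanSpace.single b 1) 2) →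
        (∀ z ∈ W, (fderiv ℝ (fun x => fderiv ℝ (v z.1) x (EuclideanSpace.single 2 1) 2) z.2 (EuclideanSpace.single 0 1) *
                fderiv ℝ (v z.1) z.2 (EuclideanSpace.single 1 1) 2 -
              fderiv ℝ (fun x => fderiv ℝ (v z.1) x (EuclideanSpace.single 2 1) 2) z.2 (EuclideanSpace.single 1 1) *
                fderiv ℝ (v z.1) z.2 (EuclideanSpace.single 0 1) 2 ≠ 0)) →
        (∃ m : ℝ → ℝ → ℝ, ∀ z ∈ W, ∀ b : Fin 3, b ≠ 2 →
            fderiv ℝ (v z.1) z.2 (EuclideanSpace.single 2 1) b =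
              m z.1 (z.2 2) * fderiv ℝ (v z.1) z.2 (EuclideanSpace.single b 1) 2) →
        ∃ s : ℝ, s < 0 ∧ ∃ U : Set (EuclideanSpace ℝ (Fin 3)), IsOpen U ∧ U.Nonempty ∧
          ((∃ e : EuclideanSpace ℝ (Fin 3), e ≠ 0 ∧
              ∀ y ∈ U, fderiv ℝ (Literature.Analysis.FluidPDE.curl (v s)) y e = 0) ∨
           (∃ c : EuclideanSpace ℝ (Fin 3), ∀ y ∈ U,
              Literature.Analysis.FluidPDE.rotGen (Literature.Analysis.FluidPDE.curl (v s) y) =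
                fderiv ℝ (Literature.Analysis.FluidPDE.curl (v s)) y (Literature.Analysis.FluidPDE.rotGen (y - c))) ∨
           (∃ w : EuclideanSpace ℝ (Fin 3) → EuclideanSpace ℝ (Fin 3), AnalyticOnNhd ℝ w Set.univ ∧
              ¬ BddAbove (Set.range fun y => ‖w y‖) ∧ ∀ y ∈ U, v s y = w y)) :=
  twistingTHGerm_of_branches fun C v hrate hcont hmild hdiv hpol hne hhot W hW hWne hWs hTHW => by
    obtain ⟨hnf, μ, Kμ, k, xp, xm, B₁, hTH, hμb, hμt, hμz, hμzz, hxp2, hxm2, hxpC, hxmC, hmax, hmin, hxpz, hxmz⟩ :=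
      hBR C v hrate hcont hmild hdiv hpol hne hhot W hW hWne hWs hTHW
    exact ⟨μ, Kμ, k, xp, xm, B₁, hTH, contDiffOn_slope_of_nonflat hrate hcont hmild hTH hnf, hμb, hμt, hμz, hμzz, hxp2, hxm2, hxpC, hxmC,
      hmax, hmin, hxpz, hxmz⟩

/-- **THE CLASS ROAD TO `stub_twistingTHGerm` BY NAME FROM «UNIFORM NON-FLATNESS + (BR)»** — the slope and its dictionary are eliminated
(`exists_globalSlope_of_window_nonflat`, `slopeRates_of_nonflat`); exponents are harmonised to `3k`. -/
theorem twistingTHGerm_of_branches_uniform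
    (hBR : ∀ (C : ℝ) (v : ℝ → EuclideanSpace ℝ (Fin 3) → EuclideanSpace ℝ (Fin 3)),
      Literature.Analysis.FluidPDE.HasTypeITimeDecay C v →
      ContinuousOn (Function.uncurry v) (Set.Iio (0 : ℝ) ×ˢ Set.univ) →
      (∀ s t : ℝ, s < t → t < 0 → ∀ x, v t x =
        Literature.Analysis.UnboundedOperators.heatExtension (v s) (t - s) x -
          Literature.Analysis.FluidPDE.oseenDuhamel 1 s v v t x) →
      (∀ t < 0, Literature.Analysis.FluidPDE.VectorCalculus.IsDivFree (v t)) →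
      (∀ s < 0, ∀ y, ⟪Literature.Analysis.FluidPDE.curl (v s) y, EuclideanSpace.single 2 1⟫_ℝ = 0) →
      v (-1) 0 2 ≠ 0 → (∀ t < 0, ∀ x, Real.sqrt (-t) * |v t x 2| ≤ |v (-1) 0 2|) →
      ∀ W : Set (ℝ × EuclideanSpace ℝ (Fin 3)), IsOpen W → W.Nonempty → W ⊆ Set.Iio (0 : ℝ) ×ˢ Set.univ →
        (∃ m : ℝ → ℝ → ℝ, ∀ z ∈ W, ∀ b : Fin 3, b ≠ 2 →
            fderiv ℝ (v z.1) z.2 (EuclideanSpace.single 2 1) b =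
              m z.1 (z.2 2) * fderiv ℝ (v z.1) z.2 (EuclideanSpace.single b 1) 2) →
        ∃ (g₀ : ℝ) (k : ℕ) (xp xm : ℝ → ℝ → EuclideanSpace ℝ (Fin 3)) (B₁ : ℝ), 0 < g₀ ∧
          (∀ t < 0, ∀ z : ℝ, ∃ y : EuclideanSpace ℝ (Fin 3), ∃ b : Fin 3, y 2 = z ∧ b ≠ 2 ∧
            g₀ * ((1 + z ^ 2 / (-t)) ^ k)⁻¹ ≤ (-t) * |(fderiv ℝ (v t) y (EuclideanSpace.single b 1)) 2|) ∧
          (∀ t < 0, ∀ z, xp t z 2 = z) ∧ (∀ t < 0, ∀ z, xm t z 2 = z) ∧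
          ContDiffOn ℝ 2 (Function.uncurry xp) (Set.Iio (0 : ℝ) ×ˢ Set.univ) ∧
          ContDiffOn ℝ 2 (Function.uncurry xm) (Set.Iio (0 : ℝ) ×ˢ Set.univ) ∧
          (∀ t < 0, ∀ z, ∀ y : EuclideanSpace ℝ (Fin 3), y 2 = z → v t y 2 ≤ v t (xp t z) 2) ∧
          (∀ t < 0, ∀ z, ∀ y : EuclideanSpace ℝ (Fin 3), y 2 = z → v t (xm t z) 2 ≤ v t y 2) ∧
          (∀ t < 0, ∀ z, ‖deriv (xp t) z‖ ≤ B₁ * (1 + z ^ 2 / (-t)) ^ k) ∧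
          (∀ t < 0, ∀ z, ‖deriv (xm t) z‖ ≤ B₁ * (1 + z ^ 2 / (-t)) ^ k)) :
    ∀ (C : ℝ) (v : ℝ → EuclideanSpace ℝ (Fin 3) → EuclideanSpace ℝ (Fin 3)),
      Literature.Analysis.FluidPDE.HasTypeITimeDecay C v →
      ContinuousOn (Function.uncurry v) (Set.Iio (0 : ℝ) ×ˢ Set.univ) →
      (∀ s t : ℝ, s < t → t < 0 → ∀ x, v t x =
        Literature.Analysis.UnboundedOperators.heatExtension (v s) (t - s) x -
          Literature.Analysis.FluidPDE.oseenDuhamel 1 s v v t x) →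
      (∀ t < 0, Literature.Analysis.FluidPDE.VectorCalculus.IsDivFree (v t)) →
      (∀ s < 0, ∀ y, ⟪Literature.Analysis.FluidPDE.curl (v s) y, EuclideanSpace.single 2 1⟫_ℝ = 0) →
      v (-1) 0 2 ≠ 0 → (∀ t < 0, ∀ x, Real.sqrt (-t) * |v t x 2| ≤ |v (-1) 0 2|) →
      (∀ h : EuclideanSpace ℝ (Fin 3), fderiv ℝ (v (-1)) 0 h 2 = 0) →
      (deriv (fun s => v s 0 2) (-1) = v (-1) 0 2 / 2 ∧ v (-1) 0 2 * (Δ (fun y => v (-1) y 2)) 0 ≤ 0) →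
      ∀ W : Set (ℝ × EuclideanSpace ℝ (Fin 3)), IsOpen W → W.Nonempty → W ⊆ Set.Iio (0 : ℝ) ×ˢ Set.univ →
        (∀ z ∈ W, (Literature.Analysis.FluidPDE.curl (v z.1) z.2 ≠ 0 ∧
            (fderiv ℝ (v z.1) z.2 (EuclideanSpace.single 0 1) 2 ≠ 0 ∨ fderiv ℝ (v z.1) z.2 (EuclideanSpace.single 1 1) 2 ≠ 0) ∧
            (fderiv ℝ (v z.1) z.2 (EuclideanSpace.single 2 1) 0 ≠ 0 ∨ fderiv ℝ (v z.1) z.2 (EuclideanSpace.single 2 1) 1 ≠ 0))) →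
        (∀ m : ℝ → ℝ, ∀ W₁ : Set (ℝ × EuclideanSpace ℝ (Fin 3)), W₁ ⊆ W → IsOpen W₁ → W₁.Nonempty →
            ∃ z ∈ W₁, ∃ b : Fin 3, b ≠ 2 ∧
              fderiv ℝ (v z.1) z.2 (EuclideanSpace.single 2 1) b ≠
                m z.1 * fderiv ℝ (v z.1) z.2 (EuclideanSpace.single b 1) 2) →
        (∀ z ∈ W, (fderiv ℝ (fun x => fderiv ℝ (v z.1) x (EuclideanSpace.single 2 1) 2) z.2 (EuclideanSpace.single 0 1) *
                fderiv ℝ (v z.1) z.2 (EuclideanSpace.single 1 1) 2 -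
              fderiv ℝ (fun x => fderiv ℝ (v z.1) x (EuclideanSpace.single 2 1) 2) z.2 (EuclideanSpace.single 1 1) *
                fderiv ℝ (v z.1) z.2 (EuclideanSpace.single 0 1) 2 ≠ 0)) →
        (∃ m : ℝ → ℝ → ℝ, ∀ z ∈ W, ∀ b : Fin 3, b ≠ 2 →
            fderiv ℝ (v z.1) z.2 (EuclideanSpace.single 2 1) b =
              m z.1 (z.2 2) * fderiv ℝ (v z.1) z.2 (EuclideanSpace.single b 1) 2) →
        ∃ s : ℝ, s < 0 ∧ ∃ U : Set (EuclideanSpace ℝ (Fin 3)), IsOpen U ∧ U.Nonempty ∧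
          ((∃ e : EuclideanSpace ℝ (Fin 3), e ≠ 0 ∧
              ∀ y ∈ U, fderiv ℝ (Literature.Analysis.FluidPDE.curl (v s)) y e = 0) ∨
           (∃ c : EuclideanSpace ℝ (Fin 3), ∀ y ∈ U,
              Literature.Analysis.FluidPDE.rotGen (Literature.Analysis.FluidPDE.curl (v s) y) =
                fderiv ℝ (Literature.Analysis.FluidPDE.curl (v s)) y (Literature.Analysis.FluidPDE.rotGen (y - c))) ∨
           (∃ w : EuclideanSpace ℝ (Fin 3) → EuclideanSpace ℝ (Fin 3), AnalyticOnNhd ℝ w Set.univ ∧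
              ¬ BddAbove (Set.range fun y => ‖w y‖) ∧ ∀ y ∈ U, v s y = w y)) :=
  twistingTHGerm_of_branches fun C v hrate hcont hmild hdiv hpol hne hhot W hW hWne hWs hTHW => by
    obtain ⟨g₀, k, xp, xm, B₁, hg₀, hg, hxp2, hxm2, hxpC, hxmC, hmax, hmin, hxpz, hxmz⟩ :=
      hBR C v hrate hcont hmild hdiv hpol hne hhot W hW hWne hWs hTHW
    obtain ⟨m, hm⟩ := hTHW
    -- qualitative non-flatness and the global slope
    have hP : ∀ t < 0, ∀ z : ℝ, (1 : ℝ) ≤ (1 + z ^ 2 / (-t)) ^ k := fun t ht z =>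
      one_le_pow₀ (le_add_of_nonneg_right (div_nonneg (sq_nonneg z) (neg_pos.2 ht).le))
    have hnf : ∀ s < 0, ∀ c : ℝ, ∃ y : EuclideanSpace ℝ (Fin 3), ∃ b : Fin 3,
        y 2 = c ∧ b ≠ 2 ∧ fderiv ℝ (v s) y (EuclideanSpace.single b 1) 2 ≠ 0 := by
      intro s hs c
      obtain ⟨y, b, hy, hb, hG⟩ := hg s hs c
      refine ⟨y, b, hy, hb, fun h0 => ?_⟩
      rw [h0, abs_zero, mul_zero] at hG
      have : 0 < g₀ * ((1 + c ^ 2 / (-s)) ^ k)⁻¹ := mul_pos hg₀ (inv_pos.2 (lt_of_lt_of_le one_pos (hP s hs c)))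
      linarith
    obtain ⟨μ, hTH, hμC⟩ := exists_globalSlope_of_window_nonflat hrate hcont hmild hW hWne hWs hm hnf
    obtain ⟨Kμ, -, hμb, hμt, hμz, hμzz⟩ := slopeRates_of_nonflat hrate hcont hmild hdiv hTH hμC hg₀ hg
    -- harmonise the exponents: `k ↦ 3k` for the branch-slope bounds
    have hB0 : 0 ≤ B₁ := by
      have h := hxpz (-1) (by norm_num) 0
      have e : (1 + (0:ℝ) ^ 2 / (-(-1:ℝ))) ^ k = 1 := by simp
      rw [e, mul_one] at h
      exact (norm_nonneg _).trans h
    have hP3 : ∀ t < 0, ∀ z : ℝ, (1 + z ^ 2 / (-t)) ^ k ≤ (1 + z ^ 2 / (-t)) ^ (3 * k) := fun t ht z =>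
      (poly_cube_facts ht z k).2.1
    exact ⟨μ, Kμ, 3 * k, xp, xm, B₁, hTH, hμC, hμb, hμt, hμz, hμzz, hxp2, hxm2, hxpC, hxmC, hmax, hmin,
      fun t ht z => (hxpz t ht z).trans (mul_le_mul_of_nonneg_left (hP3 t ht z) hB0),
      fun t ht z => (hxmz t ht z).trans (mul_le_mul_of_nonneg_left (hP3 t ht z) hB0)⟩

end Summit.NavierStokesRegularity.NavierStokesRegularity.Theorems.PoloidalWindowDoorLrcModEntireTwistingTHGlobalSlope
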